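import Summits.HubbardSuperconductivity.HubbardSuperconductivity.Theorems.BalabanIRBirComplexStableXYRRotorWitnessChain
import Literature.Probability.LatticeModels.RotatorAngleCubeGinibre
import HarnessLib

/-!
# RP-free long-range order of the `(2+1)`-dimensional XY rotor on `(ℤ/L)² × ℤ/M`:
# III. The rung, in the crux's angle-cube vocabulary

Third file of the BC5 witness for `BirComplexStableXYR` (stmt-HubbardSuperconductivity-14845,
route `BalabanIR`).  The crux speaks of angle fields `θ : Λ → ℝ` on `Λ = (ℤ/L)² × (ℤ/M)`
integrated over the cube `[0,2π]^Λ` with Lebesgue measure, the action `K ∑_s F(θ ∘ sh_s)` and the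
equal-time slice order `O = |L⁻² ∑_x e^{iθ(x,0)}|²`; its real-XY calibration (the retired route
item `BirSliceXYOrderRP`, proved by reflection positivity for EVEN `L, M`, `K ≥ 128`) reads

  `∃ K₀ L₀, ∀ K ≥ K₀, ∀ L₀ ≤ L ≤ M (L, M even), 1/2 ≤ ∫ O e^{K E} / ∫ e^{K E}`,
  `E(θ) = ∑_s [cos(θ_s − θ_{s+e₁}) + cos(θ_s − θ_{s+e₂}) + cos(θ_s − θ_{s+e_τ})]`.

Here we prove the SAME conclusion WITHOUT the parity hypotheses and WITHOUT reflection positivity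
(`birSliceXYOrder_rpFree`), from the all-pairs equal-time bound of file II
(`xyRotor_slice_twoPoint_ge_half`, Garban–Spencer's Bayesian path estimator run through imaginary
time and chained), via the folklore dictionary between the angle cube and the torus `U(1)^Λ`
(`setIntegral_angleCube_comp_exp` of the tree): the XY weight of the space-time bond system
`JCurrent.bondSystem 2 L M` at `e^{iθ}` is `exp(K E(θ))` (`xyWeight_exp_eq`), the slice order is
`L⁻⁴ ∑_{x,y} cos(θ_{(x,0)} − θ_{(y,0)})` (`sliceOrder_eq_sum_cosDiff`), so the cube ratio is the
Gibbs expectation of `L⁻⁴ ∑_{x,y} cosDiff` (`sliceOrder_ratio_eq_expect`), which is `≥ 1/2` as soon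
as every equal-time two-point function is.

Why this is a BC5 witness for the crux and not inside the known regime: the only other proof of
slice order in the tree (`birSliceXYOrderRP_proof`) is Fröhlich–Simon–Spencer reflection
positivity, which needs even side lengths and reflection-symmetric real weights and is exactly
what the complex Berry weights of `BirComplexStableXYR` destroy; the present proof uses neither
parity, nor translation invariance, nor any positivity beyond that of the real XY weight itself.

## References
* C. Garban, T. Spencer, J. Math. Phys. 63 (2022) 093302, arXiv:2109.01617, Thm. 1.3 with
  Remark 1. [GarbanSpencer2022]
* J. Fröhlich, B. Simon, T. Spencer, Comm. Math. Phys. 50 (1976) 79–95 (the RP proof, for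
  comparison). [FrohlichSimonSpencer1976]
-/

noncomputable section

set_option linter.dupNamespace false -- summit = problem name (single-conjunct summit), D-0017

namespace Summit.HubbardSuperconductivity.HubbardSuperconductivity.Theorems

open MeasureTheory Finset Set
open scoped BigOperators ComplexConjugate
open Literature.Probability.LatticeModels

/-! ### The dictionary: angle fields versus `U(1)`-valued fields -/

/-- `cos(θ_x − θ_y)` in the two renderings: `cosDiff x y (e^{iθ}) = cos(θ x − θ y)`. [folklore] -/
theorem cosDiff_exp {V : Type*} (x y : V) (θ : V → ℝ) :
    cosDiff x y (fun v => Circle.exp (θ v)) = Real.cos (θ x - θ y) := by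
  rw [cosDiff, ← Circle.coe_inv_eq_conj, ← Circle.exp_neg, ← Circle.coe_mul, ← Circle.exp_add,
    Circle.coe_exp, Complex.exp_ofReal_mul_I_re, neg_add_eq_sub, ← Real.cos_neg, neg_sub]

/-- The spatial unit vectors of `(ℤ/L)²` as `Pi.single`: `e₀ = ![1, 0]`, `e₁ = ![0, 1]`. [folklore] -/
theorem pi_single_fin_two (L : ℕ) :
    (Pi.single (0 : Fin 2) (1 : ZMod L) : TorusSite 2 L) = ![1, 0] ∧
      (Pi.single (1 : Fin 2) (1 : ZMod L) : TorusSite 2 L) = ![0, 1] := by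
  constructor <;> (funext j; fin_cases j <;> simp)

/-- **The XY weight of the space-time bond system in angles.** For the bond system of
`(ℤ/L)² × ℤ/M` (bonds `s → s + e_μ`, `μ ∈ {1, 2, τ}`) and an angle field `θ`,
`weight K 1 (e^{iθ}) = exp(K ∑_s [cos(θ_s − θ_{s+e₁}) + cos(θ_s − θ_{s+e₂}) + cos(θ_s − θ_{s+e_τ})])`.
[folklore] -/
theorem xyWeight_exp_eq (K : ℝ) (L M : ℕ) [NeZero L] [NeZero M] (θ : JCurrent.SpaceTimeSite 2 L M → ℝ) :
    (JCurrent.bondSystem 2 L M).weight K 1 (fun v => Circle.exp (θ v)) =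
      Real.exp (K * ∑ s : JCurrent.SpaceTimeSite 2 L M,
        (Real.cos (θ s - θ (s.1 + ![1, 0], s.2)) + Real.cos (θ s - θ (s.1 + ![0, 1], s.2)) +
          Real.cos (θ s - θ (s.1, s.2 + 1)))) := by
  simp only [BondSystem.weight]
  congr 2
  -- the energy is the sum over bonds `(s, μ)` of `cos(θ_{tgt} − θ_{src})`
  have hbond : ∀ a : JCurrent.Bond 2 L M,
      (((JCurrent.bondSystem 2 L M).bondVar 1 (fun v => Circle.exp (θ v)) a : Circle) : ℂ).re =
        Real.cos (θ a.1 - θ (a.1 + JCurrent.unitVec a.2)) := by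
    intro a
    have h := cosDiff_exp (V := JCurrent.SpaceTimeSite 2 L M) a.1 (a.1 + JCurrent.unitVec a.2) θ
    rw [cosDiff] at h
    rw [BondSystem.coe_bondVar, Pi.one_apply, Circle.coe_one, one_mul]
    exact h
  rw [BondSystem.energy]
  simp_rw [hbond]
  rw [Fintype.sum_prod_type]
  refine Finset.sum_congr rfl fun s _ => ?_
  rw [Fintype.sum_option, Fin.sum_univ_two]
  obtain ⟨h0, h1⟩ := pi_single_fin_two L
  simp only [JCurrent.unitVec, h0, h1]
  have e1 : s + ((0 : TorusSite 2 L), (1 : ZMod M)) = (s.1, s.2 + 1) := by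
    ext <;> simp
  have e2 : s + ((![1, 0] : TorusSite 2 L), (0 : ZMod M)) = (s.1 + ![1, 0], s.2) := by
    ext <;> simp
  have e3 : s + ((![0, 1] : TorusSite 2 L), (0 : ZMod M)) = (s.1 + ![0, 1], s.2) := by
    ext <;> simp
  rw [e1, e2, e3]
  ring

/-- **The slice order in the two renderings**: `|∑_x e^{iθ(x,0)}|² = ∑_{x,y} cos(θ_{(x,0)} − θ_{(y,0)})`,
i.e. `O(θ) = L⁻⁴ ∑_{x,y} cosDiff (x,0) (y,0) (e^{iθ})`. [folklore] -/
theorem sliceOrder_eq_sum_cosDiff (L M : ℕ) [NeZero L] [NeZero M] (θ : JCurrent.SpaceTimeSite 2 L M → ℝ) :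
    ‖∑ x : TorusSite 2 L, Complex.exp (Complex.I * (θ (x, 0) : ℂ))‖ ^ 2 / (L : ℝ) ^ 4 =
      (∑ x : TorusSite 2 L, ∑ y : TorusSite 2 L,
        cosDiff ((x, 0) : JCurrent.SpaceTimeSite 2 L M) ((y, 0)) (fun v => Circle.exp (θ v))) / (L : ℝ) ^ 4 := by
  congr 1
  have hz : ∀ x : TorusSite 2 L, Complex.exp (Complex.I * (θ (x, 0) : ℂ)) =
      ((Circle.exp (θ ((x, 0) : JCurrent.SpaceTimeSite 2 L M)) : Circle) : ℂ) := by
    intro x; rw [Circle.coe_exp, mul_comm]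
  simp_rw [hz]
  have hn : ∀ w : ℂ, ‖w‖ ^ 2 = (conj w * w).re := fun w => by
    rw [Complex.conj_mul', ← Complex.ofReal_pow, Complex.ofReal_re]
  rw [hn, map_sum, Finset.sum_mul, Complex.re_sum]
  refine Finset.sum_congr rfl fun x _ => ?_
  rw [Finset.mul_sum, Complex.re_sum]
  rfl

/-- **The cube ratio is a Gibbs expectation.** For every `K`, `L, M ≥ 1`:
`∫_{[0,2π]^Λ} O e^{K E} dθ / ∫_{[0,2π]^Λ} e^{K E} dθ = ⟨L⁻⁴ ∑_{x,y} cosDiff (x,0) (y,0)⟩_K`, the XY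
Gibbs expectation on the bond system of the space-time torus (the factors `(2π)^{|Λ|}` of the
change of variables `θ ↦ e^{iθ}` cancel). [folklore] -/
theorem sliceOrder_ratio_eq_expect (K : ℝ) (L M : ℕ) [NeZero L] [NeZero M] :
    (∫ θ in Set.pi Set.univ (fun _ : JCurrent.SpaceTimeSite 2 L M => Set.Icc (0 : ℝ) (2 * Real.pi)),
        (‖∑ x : TorusSite 2 L, Complex.exp (Complex.I * (θ (x, 0) : ℂ))‖ ^ 2 / (L : ℝ) ^ 4) *
          Real.exp (K * ∑ s : JCurrent.SpaceTimeSite 2 L M,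
            (Real.cos (θ s - θ (s.1 + ![1, 0], s.2)) + Real.cos (θ s - θ (s.1 + ![0, 1], s.2)) +
              Real.cos (θ s - θ (s.1, s.2 + 1))))) /
      (∫ θ in Set.pi Set.univ (fun _ : JCurrent.SpaceTimeSite 2 L M => Set.Icc (0 : ℝ) (2 * Real.pi)),
        Real.exp (K * ∑ s : JCurrent.SpaceTimeSite 2 L M,
          (Real.cos (θ s - θ (s.1 + ![1, 0], s.2)) + Real.cos (θ s - θ (s.1 + ![0, 1], s.2)) +
            Real.cos (θ s - θ (s.1, s.2 + 1))))) =
    (JCurrent.bondSystem 2 L M).expect K 1 (fun φ =>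
      (∑ x : TorusSite 2 L, ∑ y : TorusSite 2 L,
        cosDiff ((x, 0) : JCurrent.SpaceTimeSite 2 L M) ((y, 0)) φ) / (L : ℝ) ^ 4) := by
  set G := JCurrent.bondSystem 2 L M with hG
  set Oc : (JCurrent.SpaceTimeSite 2 L M → Circle) → ℝ := fun φ =>
    (∑ x : TorusSite 2 L, ∑ y : TorusSite 2 L,
      cosDiff ((x, 0) : JCurrent.SpaceTimeSite 2 L M) ((y, 0)) φ) / (L : ℝ) ^ 4 with hOc
  have hOcc : Continuous Oc := by
    rw [hOc]
    exact (continuous_finsetSum _ fun x _ => continuous_finsetSum _ fun y _ =>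
      continuous_cosDiff _ _).div_const _
  have hwc : Continuous (G.weight K 1) := G.continuous_weight K 1
  have h1 := setIntegral_angleCube_comp_exp (V := JCurrent.SpaceTimeSite 2 L M)
    (fun φ => Oc φ * G.weight K 1 φ) (hOcc.mul hwc).aestronglyMeasurable
  have h2 := setIntegral_angleCube_comp_exp (V := JCurrent.SpaceTimeSite 2 L M)
    (G.weight K 1) hwc.aestronglyMeasurable
  simp only [smul_eq_mul] at h1 h2
  -- the cube integrands are the torus integrands at `e^{iθ}`
  have key1 : (fun θ : JCurrent.SpaceTimeSite 2 L M → ℝ =>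
      (‖∑ x : TorusSite 2 L, Complex.exp (Complex.I * (θ (x, 0) : ℂ))‖ ^ 2 / (L : ℝ) ^ 4) *
        Real.exp (K * ∑ s : JCurrent.SpaceTimeSite 2 L M,
          (Real.cos (θ s - θ (s.1 + ![1, 0], s.2)) + Real.cos (θ s - θ (s.1 + ![0, 1], s.2)) +
            Real.cos (θ s - θ (s.1, s.2 + 1))))) =
      fun θ => Oc (fun v => Circle.exp (θ v)) * G.weight K 1 (fun v => Circle.exp (θ v)) := by
    funext θ
    rw [hOc, hG, xyWeight_exp_eq, sliceOrder_eq_sum_cosDiff L M θ]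
  have key2 : (fun θ : JCurrent.SpaceTimeSite 2 L M → ℝ =>
      Real.exp (K * ∑ s : JCurrent.SpaceTimeSite 2 L M,
        (Real.cos (θ s - θ (s.1 + ![1, 0], s.2)) + Real.cos (θ s - θ (s.1 + ![0, 1], s.2)) +
          Real.cos (θ s - θ (s.1, s.2 + 1))))) =
      fun θ => G.weight K 1 (fun v => Circle.exp (θ v)) := by
    funext θ
    rw [hG, xyWeight_exp_eq]
  rw [key1, key2, h1, h2, BondSystem.expect, BondSystem.partitionFn, mul_div_mul_left _ _ (by positivity)]

/-! ### The rung -/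

/-- **BC5 WITNESS (RP-free rung) for `BirComplexStableXYR`: equal-time slice order of the
`(2+1)`-dimensional XY rotor on `(ℤ/L)² × ℤ/M`, without parity hypotheses and without reflection
positivity.**  There are `K₀, L₀` such that for all `K ≥ K₀` and ALL `L₀ ≤ L ≤ M` (no evenness),
the classical XY model `exp(K ∑_s [cos(θ_s − θ_{s+e₁}) + cos(θ_s − θ_{s+e₂}) + cos(θ_s − θ_{s+e_τ})]) dθ`
on the angle cube `[0,2π]^Λ`, `Λ = (ℤ/L)² × ℤ/M`, has slice order
`⟨|L⁻² ∑_x e^{iθ(x,0)}|²⟩ ≥ 1/2` — uniformly in the imaginary-time extent `M ≥ L` (in particular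
`M ≫ L²`, the ground-state regime of the integer-filling quantum rotor).  This is the statement of
the retired calibration item `BirSliceXYOrderRP` with its hypotheses `Even L`, `Even M` DELETED; the
proof is Garban–Spencer's Bayesian path estimator (Nishimori gauge, Messager–Miracle-Solé–Pfister)
run through imaginary time (files I–II), not Fröhlich–Simon–Spencer reflection positivity.
[cite: GarbanSpencer2022, Theorem 1.3 with Remark 1] -/
theorem birSliceXYOrder_rpFree :
    ∃ K₀ : ℝ, ∃ L₀ : ℕ, ∀ K : ℝ, K₀ ≤ K → ∀ (L M : ℕ) [NeZero L] [NeZero M], L₀ ≤ L → L ≤ M → let E : ((Literature.Probability.LatticeModels.TorusSite 2 L × ZMod M) → ℝ) → ℝ := fun θ => ∑ s : (Literature.Probability.LatticeModels.TorusSite 2 L × ZMod M), (Real.cos (θ s - θ (s.1 + ![1, 0], s.2)) + Real.cos (θ s - θ (s.1 + ![0, 1], s.2)) + Real.cos (θ s - θ (s.1, s.2 + 1))); let cube : Set ((Literature.Probability.LatticeModels.TorusSite 2 L × ZMod M) → ℝ) := Set.pi Set.univ (fun _ => Set.Icc (0:ℝ) (2 * Real.pi)); let Z : ℝ := MeasureTheory.integral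 (MeasureTheory.volume.restrict cube) (fun θ => Real.exp (K * E θ)); let O : ((Literature.Probability.LatticeModels.TorusSite 2 L × ZMod M) → ℝ) → ℝ := fun θ => ‖∑ x : Literature.Probability.LatticeModels.TorusSite 2 L, Complex.exp (Complex.I * (θ (x, 0) : ℂ))‖ ^ 2 / (L : ℝ) ^ 4; (1/2 : ℝ) ≤ MeasureTheory.integral (MeasureTheory.volume.restrict cube) (fun θ => O θ * Real.exp (K * E θ)) / Z := by
  obtain ⟨K₂, hK₂, hall⟩ := xyRotor_slice_twoPoint_ge_half
  refine ⟨K₂, 40, fun K hK L M _ _ hL hLM => ?_⟩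
  dsimp only
  rw [sliceOrder_ratio_eq_expect K L M]
  set G := JCurrent.bondSystem 2 L M with hG
  -- linearity: `⟨L⁻⁴ ∑∑ cosDiff⟩ = L⁻⁴ ∑∑ ⟨cosDiff⟩`
  have hlin : G.expect K 1 (fun φ => (∑ x : TorusSite 2 L, ∑ y : TorusSite 2 L,
      cosDiff ((x, 0) : JCurrent.SpaceTimeSite 2 L M) ((y, 0)) φ) / (L : ℝ) ^ 4) =
      (∑ x : TorusSite 2 L, ∑ y : TorusSite 2 L,
        G.expect K 1 (cosDiff ((x, 0) : JCurrent.SpaceTimeSite 2 L M) ((y, 0)))) / (L : ℝ) ^ 4 := by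
    have e : (fun φ : JCurrent.SpaceTimeSite 2 L M → Circle => (∑ x : TorusSite 2 L, ∑ y : TorusSite 2 L,
        cosDiff ((x, 0) : JCurrent.SpaceTimeSite 2 L M) ((y, 0)) φ) / (L : ℝ) ^ 4) =
        fun φ => ((L : ℝ) ^ 4)⁻¹ * ∑ x : TorusSite 2 L, ∑ y : TorusSite 2 L,
          cosDiff ((x, 0) : JCurrent.SpaceTimeSite 2 L M) ((y, 0)) φ := funext fun φ => by
      rw [div_eq_inv_mul]
    rw [e, xyExpect_const_mul, div_eq_inv_mul]
    congr 1
    rw [xyExpect_sum G K 1 Finset.univ _ (fun x => continuous_finsetSum _ fun y _ => continuous_cosDiff _ _)]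
    refine Finset.sum_congr rfl fun x _ => ?_
    exact xyExpect_sum G K 1 Finset.univ _ (fun y => continuous_cosDiff _ _)
  rw [hlin]
  -- every equal-time pair is `≥ 1/2`
  have hpair : ∀ x y : TorusSite 2 L,
      (1 / 2 : ℝ) ≤ G.expect K 1 (cosDiff ((x, 0) : JCurrent.SpaceTimeSite 2 L M) ((y, 0))) :=
    fun x y => hall K hK L M hL hLM x y
  have hcard : (Fintype.card (TorusSite 2 L) : ℝ) = (L : ℝ) ^ 2 := by
    rw [Fintype.card_fun, ZMod.card, Fintype.card_fin]; push_cast; ring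
  have hL0 : (0 : ℝ) < L := by exact_mod_cast Nat.pos_of_ne_zero (NeZero.ne L)
  have hsum : (1 / 2 : ℝ) * (L : ℝ) ^ 4 ≤ ∑ x : TorusSite 2 L, ∑ y : TorusSite 2 L,
      G.expect K 1 (cosDiff ((x, 0) : JCurrent.SpaceTimeSite 2 L M) ((y, 0))) := by
    calc (1 / 2 : ℝ) * (L : ℝ) ^ 4 = ∑ _x : TorusSite 2 L, ∑ _y : TorusSite 2 L, (1 / 2 : ℝ) := by
          rw [Finset.sum_const, Finset.sum_const, Finset.card_univ, nsmul_eq_mul, nsmul_eq_mul, hcard]; ring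
      _ ≤ _ := Finset.sum_le_sum fun x _ => Finset.sum_le_sum fun y _ => hpair x y
  rw [le_div_iff₀ (by positivity)]
  exact hsum

end Summit.HubbardSuperconductivity.HubbardSuperconductivity.Theorems

end
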